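import Mathlib
import HarnessLib
import Summits.Ventures.LatticeQCDFlow.Exactness.U1SubstepForceTransfer

/-!
# `U(1)` rung: TRANSFER OF THE LIPSCHITZ CONSTANT OF THE EXACT FORCE THROUGH ONE MASKED WILSON-FLOW SUB-STEP — explicit, volume-independent

HONEST FRAMING: exact (Metropolis-corrected) sampling algorithms for lattice gauge theory;
figures of merit are autocorrelation/cost numbers at stated couplings and volumes; no
continuum-physics claim.

Venture `LatticeQCDFlow` (cell pub-lqcd), topic `Exactness`; FANOUT row 14 (`eng-flowhmc`, engine
`latflow.fthmc`, family B, `U(1)` rung).  NEW WORK of the cell over this row's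
`U1SubstepForceTransfer` (sup transfer, real bookkeeping `abs_sum_mul_sub_sum_mul_le`,
`abs_div_sub_div_le_of_le`, `u1Factor_ge`), `U1SubstepForceChainRule` / `U1SubstepLogJacobianForce`
(closed forms), `U1SubstepForceBounds` (`Σ|M| ≤ 8(d−1)`, `Σ|ΔM|, Σ|ΔN| ≤ 32(d−1)·dist`, `Σ|N| ≤ 8(d−1)`)
and `U1SubstepLipschitz` (`dist(fV,fV') ≤ (1+8(d−1)|ε|)·dist`, `|ΔC| ≤ 8(d−1)·dist`); nothing is cited
as a fact; no number.  Sub-step `f`, field `Z`, factor `C`, booked density `J` VERBATIM as in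
`exists_layers_u1WilsonFlowLO`; `g_S(W)(e) = κ · fderiv (p ↦ S(e^(icp)·W)) 0 (δ_e)`.

* **`abs_u1ExactForce_substep_sub_le`** — `S'` differentiable along the drift everywhere,
  `|g_(S')| ≤ B`, `|g_(S')(W)(e) − g_(S')(W')(e)| ≤ K·dist(W,W')` (`K ≥ 0`), `2(d−1)|ε| < 1`,
  `A = 8(d−1)|ε|`, `m = 1 − 2(d−1)|ε|`:

    `|g_(S'∘f − log J)(V)(e') − g_(S'∘f − log J)(V')(e')|`
      `≤ [K(1+A)² + 32(d−1)|ε|B + |κ||c||ε|(32(d−1)/m + 64(d−1)²|ε|/m²)] · dist(V, V')`.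

  Together with `abs_u1ExactForce_substep_le` this is the one-layer step of the induction over any
  schedule of the LO member (`U1WilsonFlowLOExactForceLipschitz`).

NOT CLAIMED: sharpness of the constants; `SU(2)`; floating point; any number.
-/

noncomputable section

namespace Summit.Ventures.LatticeQCDFlow.Exactness

open Literature.MathematicalPhysics.QuantumFieldTheory
open scoped BigOperators

variable {d L : ℕ} {X : Type*} [DecidableEq X] (χ : Site d L → X)

/-- `|(a + εs − c) − (a' + εs' − c')| ≤ |a − a'| + |ε|·|s − s'| + |c − c'|`. -/
theorem abs_trio_sub_trio_le (a s c a' s' c' ε : ℝ) :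
    |(a + ε * s - c) - (a' + ε * s' - c')| ≤ |a - a'| + |ε| * |s - s'| + |c - c'| := by
  have h : (a + ε * s - c) - (a' + ε * s' - c') = ((a - a') + ε * (s - s')) - (c - c') := by ring
  rw [h]
  exact (abs_sub _ _).trans
    (add_le_add ((abs_add_le _ _).trans (add_le_add le_rfl (abs_mul ε _).le)) le_rfl)

variable [NeZero L]

/-- **LIPSCHITZ TRANSFER THROUGH ONE MASKED SUB-STEP** (see the module docstring). -/
theorem abs_u1ExactForce_substep_sub_le (μ : Fin d) (b : X) {ε : ℝ}
    (hε : |ε| * (2 * ((d - 1 : ℕ) : ℝ)) < 1) (c κ : ℝ) {S' : GaugeConfig d L Circle → ℝ} {B K : ℝ}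
    (hK0 : 0 ≤ K)
    (hS' : ∀ W : GaugeConfig d L Circle, DifferentiableAt ℝ
      (fun p : Edge d L → ℝ => S' ((fun i : Edge d L => Circle.exp (c * p i)) * W)) 0)
    (hB : ∀ (W : GaugeConfig d L Circle) (e : Edge d L),
      |κ * fderiv ℝ (fun p : Edge d L → ℝ => S' ((fun i : Edge d L => Circle.exp (c * p i)) * W)) 0
        (Pi.single e 1)| ≤ B)
    (hK : ∀ (W W' : GaugeConfig d L Circle) (e : Edge d L),
      |κ * fderiv ℝ (fun p : Edge d L → ℝ => S' ((fun i : Edge d L => Circle.exp (c * p i)) * W)) 0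
          (Pi.single e 1) -
        κ * fderiv ℝ (fun p : Edge d L → ℝ => S' ((fun i : Edge d L => Circle.exp (c * p i)) * W')) 0
          (Pi.single e 1)| ≤ K * dist W W')
    (V V' : GaugeConfig d L Circle) (e' : Edge d L) :
    |κ * fderiv ℝ (fun p : Edge d L → ℝ =>
      S' ((fun (V : GaugeConfig d L Circle) (e : Edge d L) => if e.2 = μ ∧ χ e.1 = b then
          V e * Circle.exp (ε * ∑ ν ∈ Finset.univ.erase e.2,
            (((plaquetteHolonomy V (e.1 - Pi.single ν 1) e.2 ν : Circle) : ℂ).im -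
              ((plaquetteHolonomy V e.1 e.2 ν : Circle) : ℂ).im)) else V e)
        ((fun i : Edge d L => Circle.exp (c * p i)) * V)) -
      Real.log ((fun V : GaugeConfig d L Circle =>
        ∏ a : {e : Edge d L // e.2 = μ ∧ χ e.1 = b},
          (1 - ε * ∑ ν ∈ Finset.univ.erase a.1.2,
            (((plaquetteHolonomy V a.1.1 a.1.2 ν : Circle) : ℂ).re +
              ((plaquetteHolonomy V (a.1.1 - Pi.single ν 1) a.1.2 ν : Circle) : ℂ).re)))
        ((fun i : Edge d L => Circle.exp (c * p i)) * V))) 0 (Pi.single e' 1) -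
    κ * fderiv ℝ (fun p : Edge d L → ℝ =>
      S' ((fun (V : GaugeConfig d L Circle) (e : Edge d L) => if e.2 = μ ∧ χ e.1 = b then
          V e * Circle.exp (ε * ∑ ν ∈ Finset.univ.erase e.2,
            (((plaquetteHolonomy V (e.1 - Pi.single ν 1) e.2 ν : Circle) : ℂ).im -
              ((plaquetteHolonomy V e.1 e.2 ν : Circle) : ℂ).im)) else V e)
        ((fun i : Edge d L => Circle.exp (c * p i)) * V')) -
      Real.log ((fun V : GaugeConfig d L Circle =>
        ∏ a : {e : Edge d L // e.2 = μ ∧ χ e.1 = b},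
          (1 - ε * ∑ ν ∈ Finset.univ.erase a.1.2,
            (((plaquetteHolonomy V a.1.1 a.1.2 ν : Circle) : ℂ).re +
              ((plaquetteHolonomy V (a.1.1 - Pi.single ν 1) a.1.2 ν : Circle) : ℂ).re)))
        ((fun i : Edge d L => Circle.exp (c * p i)) * V'))) 0 (Pi.single e' 1)| ≤
      (K * (1 + 8 * ((d - 1 : ℕ) : ℝ) * |ε|) ^ 2 + 32 * ((d - 1 : ℕ) : ℝ) * |ε| * B +
        |κ| * |c| * |ε| * (32 * ((d - 1 : ℕ) : ℝ) / (1 - |ε| * (2 * ((d - 1 : ℕ) : ℝ))) +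
          64 * ((d - 1 : ℕ) : ℝ) ^ 2 * |ε| / (1 - |ε| * (2 * ((d - 1 : ℕ) : ℝ))) ^ 2)) * dist V V' := by
  classical
  have hB0 : 0 ≤ B := (abs_nonneg _).trans (hB V e')
  have hm : 0 < 1 - |ε| * (2 * ((d - 1 : ℕ) : ℝ)) := by linarith
  have hD : 0 ≤ dist V V' := dist_nonneg
  have hD10 : 0 ≤ ((d - 1 : ℕ) : ℝ) := by positivity
  -- the two forces, in closed form
  have hdV := differentiableAt_comp_u1Substep_circleDrift χ μ b ε c V (hS' _)
  have hdV' := differentiableAt_comp_u1Substep_circleDrift χ μ b ε c V' (hS' _)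
  have hjV := (hasFDerivAt_log_u1Jacobian_circleDrift χ μ b hε c V).differentiableAt
  have hjV' := (hasFDerivAt_log_u1Jacobian_circleDrift χ μ b hε c V').differentiableAt
  rw [(hdV.hasFDerivAt.fun_sub hjV.hasFDerivAt).fderiv, (hdV'.hasFDerivAt.fun_sub hjV'.hasFDerivAt).fderiv,
    sub_apply, sub_apply, mul_sub, mul_sub,
    u1ExactForce_comp_substep χ μ b ε c κ V (hS' _) e', u1ExactForce_comp_substep χ μ b ε c κ V' (hS' _) e',
    u1ExactForce_logJacobian χ μ b hε c κ V e', u1ExactForce_logJacobian χ μ b hε c κ V' e']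
  -- the sub-step moves the fields by at most `(1 + A)·dist`
  have hf := dist_u1Substep_le χ μ b ε V V'
  have hG0 : 0 ≤ K * ((1 + 8 * ((d - 1 : ℕ) : ℝ) * |ε|) * dist V V') :=
    mul_nonneg hK0 (mul_nonneg (by positivity) hD)
  refine (abs_trio_sub_trio_le _ _ _ _ _ _ _).trans ?_
  -- (1) the force at the sub-stepped fields
  have h1 := (hK _ _ e').trans (mul_le_mul_of_nonneg_left hf hK0)
  -- (2) the `M`-weighted sum
  have h2pre := abs_sum_mul_sub_sum_mul_le (Finset.univ.filter fun e : Edge d L => e.2 = μ ∧ χ e.1 = b)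
    (fun e : Edge d L => ∑ ν ∈ Finset.univ.erase e.2,
          (((plaquetteHolonomy V (e.1 - Pi.single ν 1) e.2 ν : Circle) : ℂ).re *
              ((Pi.single e' (1 : ℝ) : Edge d L → ℝ) (e.1 - Pi.single ν 1, e.2) +
                (Pi.single e' (1 : ℝ) : Edge d L → ℝ) ((e.1 - Pi.single ν 1).shift e.2, ν) -
                (Pi.single e' (1 : ℝ) : Edge d L → ℝ) ((e.1 - Pi.single ν 1).shift ν, e.2) -
                (Pi.single e' (1 : ℝ) : Edge d L → ℝ) (e.1 - Pi.single ν 1, ν)) -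
            ((plaquetteHolonomy V e.1 e.2 ν : Circle) : ℂ).re *
              ((Pi.single e' (1 : ℝ) : Edge d L → ℝ) (e.1, e.2) +
                (Pi.single e' (1 : ℝ) : Edge d L → ℝ) (e.1.shift e.2, ν) -
                (Pi.single e' (1 : ℝ) : Edge d L → ℝ) (e.1.shift ν, e.2) -
                (Pi.single e' (1 : ℝ) : Edge d L → ℝ) (e.1, ν))))
    (fun e : Edge d L => ∑ ν ∈ Finset.univ.erase e.2,
          (((plaquetteHolonomy V' (e.1 - Pi.single ν 1) e.2 ν : Circle) : ℂ).re *
              ((Pi.single e' (1 : ℝ) : Edge d L → ℝ) (e.1 - Pi.single ν 1, e.2) +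
                (Pi.single e' (1 : ℝ) : Edge d L → ℝ) ((e.1 - Pi.single ν 1).shift e.2, ν) -
                (Pi.single e' (1 : ℝ) : Edge d L → ℝ) ((e.1 - Pi.single ν 1).shift ν, e.2) -
                (Pi.single e' (1 : ℝ) : Edge d L → ℝ) (e.1 - Pi.single ν 1, ν)) -
            ((plaquetteHolonomy V' e.1 e.2 ν : Circle) : ℂ).re *
              ((Pi.single e' (1 : ℝ) : Edge d L → ℝ) (e.1, e.2) +
                (Pi.single e' (1 : ℝ) : Edge d L → ℝ) (e.1.shift e.2, ν) -
                (Pi.single e' (1 : ℝ) : Edge d L → ℝ) (e.1.shift ν, e.2) -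
                (Pi.single e' (1 : ℝ) : Edge d L → ℝ) (e.1, ν))))
    (fun e : Edge d L => κ * fderiv ℝ (fun p : Edge d L → ℝ => S' ((fun i : Edge d L => Circle.exp (c * p i)) *
          (fun (V : GaugeConfig d L Circle) (e : Edge d L) => if e.2 = μ ∧ χ e.1 = b then
            V e * Circle.exp (ε * ∑ ν ∈ Finset.univ.erase e.2,
              (((plaquetteHolonomy V (e.1 - Pi.single ν 1) e.2 ν : Circle) : ℂ).im -
                ((plaquetteHolonomy V e.1 e.2 ν : Circle) : ℂ).im)) else V e) V)) 0 (Pi.single e 1))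
    (fun e : Edge d L => κ * fderiv ℝ (fun p : Edge d L → ℝ => S' ((fun i : Edge d L => Circle.exp (c * p i)) *
          (fun (V : GaugeConfig d L Circle) (e : Edge d L) => if e.2 = μ ∧ χ e.1 = b then
            V e * Circle.exp (ε * ∑ ν ∈ Finset.univ.erase e.2,
              (((plaquetteHolonomy V (e.1 - Pi.single ν 1) e.2 ν : Circle) : ℂ).im -
                ((plaquetteHolonomy V e.1 e.2 ν : Circle) : ℂ).im)) else V e) V')) 0 (Pi.single e 1))
    (B := B) (G := K * ((1 + 8 * ((d - 1 : ℕ) : ℝ) * |ε|) * dist V V'))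
    (fun e _ => by beta_reduce; exact hB _ e)
    (fun e _ => by beta_reduce; exact (hK _ _ e).trans (mul_le_mul_of_nonneg_left hf hK0))
  have h2 := mul_le_mul_of_nonneg_left (h2pre.trans (add_le_add
      (mul_le_mul_of_nonneg_left ((Finset.sum_le_univ_sum_of_nonneg (fun _ => abs_nonneg _)).trans
        (sum_abs_flowFieldEntry_sub_le V V' e')) hB0)
      (mul_le_mul_of_nonneg_left ((Finset.sum_le_univ_sum_of_nonneg (fun _ => abs_nonneg _)).trans
        (sum_abs_flowFieldEntry_le V' e')) hG0))) (abs_nonneg ε)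
  -- (3) the log-Jacobian part
  have hterm : ∀ a : {e : Edge d L // e.2 = μ ∧ χ e.1 = b},
      |(∑ ν ∈ Finset.univ.erase a.1.2,
          (((plaquetteHolonomy V a.1.1 a.1.2 ν : Circle) : ℂ).im *
              ((Pi.single e' (1 : ℝ) : Edge d L → ℝ) (a.1.1, a.1.2) +
                (Pi.single e' (1 : ℝ) : Edge d L → ℝ) (a.1.1.shift a.1.2, ν) -
                (Pi.single e' (1 : ℝ) : Edge d L → ℝ) (a.1.1.shift ν, a.1.2) -
                (Pi.single e' (1 : ℝ) : Edge d L → ℝ) (a.1.1, ν)) +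
            ((plaquetteHolonomy V (a.1.1 - Pi.single ν 1) a.1.2 ν : Circle) : ℂ).im *
              ((Pi.single e' (1 : ℝ) : Edge d L → ℝ) (a.1.1 - Pi.single ν 1, a.1.2) +
                (Pi.single e' (1 : ℝ) : Edge d L → ℝ) ((a.1.1 - Pi.single ν 1).shift a.1.2, ν) -
                (Pi.single e' (1 : ℝ) : Edge d L → ℝ) ((a.1.1 - Pi.single ν 1).shift ν, a.1.2) -
                (Pi.single e' (1 : ℝ) : Edge d L → ℝ) (a.1.1 - Pi.single ν 1, ν)))) /
        (1 - ε * ∑ ν ∈ Finset.univ.erase a.1.2,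
            (((plaquetteHolonomy V a.1.1 a.1.2 ν : Circle) : ℂ).re +
              ((plaquetteHolonomy V (a.1.1 - Pi.single ν 1) a.1.2 ν : Circle) : ℂ).re)) -
       (∑ ν ∈ Finset.univ.erase a.1.2,
          (((plaquetteHolonomy V' a.1.1 a.1.2 ν : Circle) : ℂ).im *
              ((Pi.single e' (1 : ℝ) : Edge d L → ℝ) (a.1.1, a.1.2) +
                (Pi.single e' (1 : ℝ) : Edge d L → ℝ) (a.1.1.shift a.1.2, ν) -
                (Pi.single e' (1 : ℝ) : Edge d L → ℝ) (a.1.1.shift ν, a.1.2) -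
                (Pi.single e' (1 : ℝ) : Edge d L → ℝ) (a.1.1, ν)) +
            ((plaquetteHolonomy V' (a.1.1 - Pi.single ν 1) a.1.2 ν : Circle) : ℂ).im *
              ((Pi.single e' (1 : ℝ) : Edge d L → ℝ) (a.1.1 - Pi.single ν 1, a.1.2) +
                (Pi.single e' (1 : ℝ) : Edge d L → ℝ) ((a.1.1 - Pi.single ν 1).shift a.1.2, ν) -
                (Pi.single e' (1 : ℝ) : Edge d L → ℝ) ((a.1.1 - Pi.single ν 1).shift ν, a.1.2) -
                (Pi.single e' (1 : ℝ) : Edge d L → ℝ) (a.1.1 - Pi.single ν 1, ν)))) /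
        (1 - ε * ∑ ν ∈ Finset.univ.erase a.1.2,
            (((plaquetteHolonomy V' a.1.1 a.1.2 ν : Circle) : ℂ).re +
              ((plaquetteHolonomy V' (a.1.1 - Pi.single ν 1) a.1.2 ν : Circle) : ℂ).re))| ≤
      |(∑ ν ∈ Finset.univ.erase a.1.2,
          (((plaquetteHolonomy V a.1.1 a.1.2 ν : Circle) : ℂ).im *
              ((Pi.single e' (1 : ℝ) : Edge d L → ℝ) (a.1.1, a.1.2) +
                (Pi.single e' (1 : ℝ) : Edge d L → ℝ) (a.1.1.shift a.1.2, ν) -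
                (Pi.single e' (1 : ℝ) : Edge d L → ℝ) (a.1.1.shift ν, a.1.2) -
                (Pi.single e' (1 : ℝ) : Edge d L → ℝ) (a.1.1, ν)) +
            ((plaquetteHolonomy V (a.1.1 - Pi.single ν 1) a.1.2 ν : Circle) : ℂ).im *
              ((Pi.single e' (1 : ℝ) : Edge d L → ℝ) (a.1.1 - Pi.single ν 1, a.1.2) +
                (Pi.single e' (1 : ℝ) : Edge d L → ℝ) ((a.1.1 - Pi.single ν 1).shift a.1.2, ν) -
                (Pi.single e' (1 : ℝ) : Edge d L → ℝ) ((a.1.1 - Pi.single ν 1).shift ν, a.1.2) -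
                (Pi.single e' (1 : ℝ) : Edge d L → ℝ) (a.1.1 - Pi.single ν 1, ν)))) -
       (∑ ν ∈ Finset.univ.erase a.1.2,
          (((plaquetteHolonomy V' a.1.1 a.1.2 ν : Circle) : ℂ).im *
              ((Pi.single e' (1 : ℝ) : Edge d L → ℝ) (a.1.1, a.1.2) +
                (Pi.single e' (1 : ℝ) : Edge d L → ℝ) (a.1.1.shift a.1.2, ν) -
                (Pi.single e' (1 : ℝ) : Edge d L → ℝ) (a.1.1.shift ν, a.1.2) -
                (Pi.single e' (1 : ℝ) : Edge d L → ℝ) (a.1.1, ν)) +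
            ((plaquetteHolonomy V' (a.1.1 - Pi.single ν 1) a.1.2 ν : Circle) : ℂ).im *
              ((Pi.single e' (1 : ℝ) : Edge d L → ℝ) (a.1.1 - Pi.single ν 1, a.1.2) +
                (Pi.single e' (1 : ℝ) : Edge d L → ℝ) ((a.1.1 - Pi.single ν 1).shift a.1.2, ν) -
                (Pi.single e' (1 : ℝ) : Edge d L → ℝ) ((a.1.1 - Pi.single ν 1).shift ν, a.1.2) -
                (Pi.single e' (1 : ℝ) : Edge d L → ℝ) (a.1.1 - Pi.single ν 1, ν))))| /
          (1 - |ε| * (2 * ((d - 1 : ℕ) : ℝ))) +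
        |∑ ν ∈ Finset.univ.erase a.1.2,
          (((plaquetteHolonomy V' a.1.1 a.1.2 ν : Circle) : ℂ).im *
              ((Pi.single e' (1 : ℝ) : Edge d L → ℝ) (a.1.1, a.1.2) +
                (Pi.single e' (1 : ℝ) : Edge d L → ℝ) (a.1.1.shift a.1.2, ν) -
                (Pi.single e' (1 : ℝ) : Edge d L → ℝ) (a.1.1.shift ν, a.1.2) -
                (Pi.single e' (1 : ℝ) : Edge d L → ℝ) (a.1.1, ν)) +
            ((plaquetteHolonomy V' (a.1.1 - Pi.single ν 1) a.1.2 ν : Circle) : ℂ).im *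
              ((Pi.single e' (1 : ℝ) : Edge d L → ℝ) (a.1.1 - Pi.single ν 1, a.1.2) +
                (Pi.single e' (1 : ℝ) : Edge d L → ℝ) ((a.1.1 - Pi.single ν 1).shift a.1.2, ν) -
                (Pi.single e' (1 : ℝ) : Edge d L → ℝ) ((a.1.1 - Pi.single ν 1).shift ν, a.1.2) -
                (Pi.single e' (1 : ℝ) : Edge d L → ℝ) (a.1.1 - Pi.single ν 1, ν)))| *
          (|ε| * (8 * ((d - 1 : ℕ) : ℝ) * dist V V')) / (1 - |ε| * (2 * ((d - 1 : ℕ) : ℝ))) ^ 2 := by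
    intro a
    refine (abs_div_sub_div_le_of_le hm (u1Factor_ge ε V a.1) (u1Factor_ge ε V' a.1)).trans ?_
    refine add_le_add le_rfl (div_le_div_of_nonneg_right (mul_le_mul_of_nonneg_left ?_ (abs_nonneg _))
      (by positivity))
    have hC := abs_u1Factor_sub_le V V' a.1
    have hre : (1 - ε * ∑ ν ∈ Finset.univ.erase a.1.2,
            (((plaquetteHolonomy V a.1.1 a.1.2 ν : Circle) : ℂ).re +
              ((plaquetteHolonomy V (a.1.1 - Pi.single ν 1) a.1.2 ν : Circle) : ℂ).re)) -
        (1 - ε * ∑ ν ∈ Finset.univ.erase a.1.2,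
            (((plaquetteHolonomy V' a.1.1 a.1.2 ν : Circle) : ℂ).re +
              ((plaquetteHolonomy V' (a.1.1 - Pi.single ν 1) a.1.2 ν : Circle) : ℂ).re)) =
        -(ε * ((∑ ν ∈ Finset.univ.erase a.1.2,
            (((plaquetteHolonomy V a.1.1 a.1.2 ν : Circle) : ℂ).re +
              ((plaquetteHolonomy V (a.1.1 - Pi.single ν 1) a.1.2 ν : Circle) : ℂ).re)) -
          ∑ ν ∈ Finset.univ.erase a.1.2,
            (((plaquetteHolonomy V' a.1.1 a.1.2 ν : Circle) : ℂ).re +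
              ((plaquetteHolonomy V' (a.1.1 - Pi.single ν 1) a.1.2 ν : Circle) : ℂ).re))) := by ring
    rw [hre, abs_neg, abs_mul]
    exact mul_le_mul_of_nonneg_left hC (abs_nonneg ε)
  have hΔN := (sum_subtype_abs_le_univ χ μ b _).trans (sum_abs_factorEntry_sub_le V V' e')
  have hN' := (sum_subtype_abs_le_univ χ μ b _).trans (sum_abs_factorEntry_le V' e')
  have h3in : |(∑ a : {e : Edge d L // e.2 = μ ∧ χ e.1 = b},
      (∑ ν ∈ Finset.univ.erase a.1.2,
          (((plaquetteHolonomy V a.1.1 a.1.2 ν : Circle) : ℂ).im *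
              ((Pi.single e' (1 : ℝ) : Edge d L → ℝ) (a.1.1, a.1.2) +
                (Pi.single e' (1 : ℝ) : Edge d L → ℝ) (a.1.1.shift a.1.2, ν) -
                (Pi.single e' (1 : ℝ) : Edge d L → ℝ) (a.1.1.shift ν, a.1.2) -
                (Pi.single e' (1 : ℝ) : Edge d L → ℝ) (a.1.1, ν)) +
            ((plaquetteHolonomy V (a.1.1 - Pi.single ν 1) a.1.2 ν : Circle) : ℂ).im *
              ((Pi.single e' (1 : ℝ) : Edge d L → ℝ) (a.1.1 - Pi.single ν 1, a.1.2) +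
                (Pi.single e' (1 : ℝ) : Edge d L → ℝ) ((a.1.1 - Pi.single ν 1).shift a.1.2, ν) -
                (Pi.single e' (1 : ℝ) : Edge d L → ℝ) ((a.1.1 - Pi.single ν 1).shift ν, a.1.2) -
                (Pi.single e' (1 : ℝ) : Edge d L → ℝ) (a.1.1 - Pi.single ν 1, ν)))) /
        (1 - ε * ∑ ν ∈ Finset.univ.erase a.1.2,
            (((plaquetteHolonomy V a.1.1 a.1.2 ν : Circle) : ℂ).re +
              ((plaquetteHolonomy V (a.1.1 - Pi.single ν 1) a.1.2 ν : Circle) : ℂ).re))) -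
      ∑ a : {e : Edge d L // e.2 = μ ∧ χ e.1 = b},
      (∑ ν ∈ Finset.univ.erase a.1.2,
          (((plaquetteHolonomy V' a.1.1 a.1.2 ν : Circle) : ℂ).im *
              ((Pi.single e' (1 : ℝ) : Edge d L → ℝ) (a.1.1, a.1.2) +
                (Pi.single e' (1 : ℝ) : Edge d L → ℝ) (a.1.1.shift a.1.2, ν) -
                (Pi.single e' (1 : ℝ) : Edge d L → ℝ) (a.1.1.shift ν, a.1.2) -
                (Pi.single e' (1 : ℝ) : Edge d L → ℝ) (a.1.1, ν)) +
            ((plaquetteHolonomy V' (a.1.1 - Pi.single ν 1) a.1.2 ν : Circle) : ℂ).im *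
              ((Pi.single e' (1 : ℝ) : Edge d L → ℝ) (a.1.1 - Pi.single ν 1, a.1.2) +
                (Pi.single e' (1 : ℝ) : Edge d L → ℝ) ((a.1.1 - Pi.single ν 1).shift a.1.2, ν) -
                (Pi.single e' (1 : ℝ) : Edge d L → ℝ) ((a.1.1 - Pi.single ν 1).shift ν, a.1.2) -
                (Pi.single e' (1 : ℝ) : Edge d L → ℝ) (a.1.1 - Pi.single ν 1, ν)))) /
        (1 - ε * ∑ ν ∈ Finset.univ.erase a.1.2,
            (((plaquetteHolonomy V' a.1.1 a.1.2 ν : Circle) : ℂ).re +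
              ((plaquetteHolonomy V' (a.1.1 - Pi.single ν 1) a.1.2 ν : Circle) : ℂ).re))| ≤
      32 * ((d - 1 : ℕ) : ℝ) * dist V V' / (1 - |ε| * (2 * ((d - 1 : ℕ) : ℝ))) +
        8 * ((d - 1 : ℕ) : ℝ) * (|ε| * (8 * ((d - 1 : ℕ) : ℝ) * dist V V')) / (1 - |ε| * (2 * ((d - 1 : ℕ) : ℝ))) ^ 2 := by
    rw [← Finset.sum_sub_distrib]
    refine ((Finset.abs_sum_le_sum_abs _ _).trans (Finset.sum_le_sum fun a _ => hterm a)).trans ?_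
    rw [Finset.sum_add_distrib, ← Finset.sum_div, ← Finset.sum_div, ← Finset.sum_mul]
    exact add_le_add (div_le_div_of_nonneg_right hΔN hm.le)
      (div_le_div_of_nonneg_right (mul_le_mul_of_nonneg_right hN' (by positivity)) (by positivity))
  have h3 : ∀ x y : ℝ, |x - y| ≤ 32 * ((d - 1 : ℕ) : ℝ) * dist V V' / (1 - |ε| * (2 * ((d - 1 : ℕ) : ℝ))) +
        8 * ((d - 1 : ℕ) : ℝ) * (|ε| * (8 * ((d - 1 : ℕ) : ℝ) * dist V V')) / (1 - |ε| * (2 * ((d - 1 : ℕ) : ℝ))) ^ 2 →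
      |κ * (c * (ε * x)) - κ * (c * (ε * y))| ≤ |κ| * |c| * |ε| *
        (32 * ((d - 1 : ℕ) : ℝ) * dist V V' / (1 - |ε| * (2 * ((d - 1 : ℕ) : ℝ))) +
          8 * ((d - 1 : ℕ) : ℝ) * (|ε| * (8 * ((d - 1 : ℕ) : ℝ) * dist V V')) / (1 - |ε| * (2 * ((d - 1 : ℕ) : ℝ))) ^ 2) := by
    intro x y hxy
    have h : κ * (c * (ε * x)) - κ * (c * (ε * y)) = (κ * (c * ε)) * (x - y) := by ring
    rw [h, abs_mul, abs_mul, abs_mul, ← mul_assoc]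
    exact mul_le_mul_of_nonneg_left hxy (by positivity)
  have h3' := h3 _ _ h3in
  -- assemble
  refine (add_le_add (add_le_add h1 h2) h3').trans (le_of_eq ?_)
  ring

/-! ## §2 Real bookkeeping for iterating the transfer over a schedule: one step of the two recursions

Iterating `abs_u1ExactForce_substep_sub_le` over the `n` layers of a member, with `A = 8(d−1)|ε|`, the
sup bound of the force obeys `B_{n+1} ≤ B_n (1+A) + u` and its Lipschitz constant
`K_{n+1} ≤ K_n (1+A)² + 4A·B_n + w`; the two lemmas below certify the closed-form majorants
`B_n ≤ (1+A)^n (b₀ + n u)` and `K_n ≤ (1+A)^(2n) (K₀ + n (4A (b₀ + n u) + w))` one step at a time (pure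
real arithmetic, volume-free).  (Moved up here from the staged sequel `U1WilsonFlowLOExactForceLipschitz`,
which runs the induction for the LO Wilson-flow member.) -/

omit [DecidableEq X] [NeZero L] in
/-- The sup-bound recursion: `B(1+A) + u ≤ (1+A)^(n+1)(b₀ + (n+1)u)` for `B = (1+A)^n(b₀ + nu)`. -/
theorem u1ForceBound_step {A u b₀ : ℝ} (n : ℕ) (hA : 0 ≤ A) (hu : 0 ≤ u) :
    (1 + A) ^ n * (b₀ + (n : ℝ) * u) * (1 + A) + u ≤
      (1 + A) ^ (n + 1) * (b₀ + ((n + 1 : ℕ) : ℝ) * u) := by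
  have hp : 1 ≤ (1 + A) ^ (n + 1) := one_le_pow₀ (by linarith)
  have h1 : u ≤ (1 + A) ^ (n + 1) * u := le_mul_of_one_le_left hu hp
  push_cast
  calc (1 + A) ^ n * (b₀ + (n : ℝ) * u) * (1 + A) + u
      = (1 + A) ^ (n + 1) * (b₀ + (n : ℝ) * u) + u := by ring
    _ ≤ (1 + A) ^ (n + 1) * (b₀ + (n : ℝ) * u) + (1 + A) ^ (n + 1) * u := by linarith
    _ = (1 + A) ^ (n + 1) * (b₀ + ((n : ℝ) + 1) * u) := by ring

omit [DecidableEq X] [NeZero L] in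
/-- The Lipschitz recursion: `K(1+A)² + c₄B + w ≤ (1+A)^(2(n+1))(K₀ + (n+1)(4A(b₀ + (n+1)u) + w))`
for `K = (1+A)^(2n)(K₀ + n(4A(b₀ + nu) + w))`, `B = (1+A)^n(b₀ + nu)`, `c₄ = 4A` (times `D ≥ 0`). -/
theorem u1ForceLipschitz_step {A u w b₀ K₀ D c₄ : ℝ} (n : ℕ) (hA : 0 ≤ A) (hu : 0 ≤ u) (hw : 0 ≤ w)
    (hb : 0 ≤ b₀) (hD : 0 ≤ D) (hc : c₄ = 4 * A) :
    ((1 + A) ^ (2 * n) * (K₀ + (n : ℝ) * (4 * A * (b₀ + (n : ℝ) * u) + w)) * (1 + A) ^ 2 +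
        c₄ * ((1 + A) ^ n * (b₀ + (n : ℝ) * u)) + w) * D ≤
      (1 + A) ^ (2 * (n + 1)) * (K₀ + ((n + 1 : ℕ) : ℝ) * (4 * A * (b₀ + ((n + 1 : ℕ) : ℝ) * u) + w)) * D := by
  subst hc
  push_cast
  have h1A : 1 ≤ 1 + A := by linarith
  have hp2 : 1 ≤ (1 + A) ^ (2 * n + 2) := one_le_pow₀ h1A
  have hp3 : (1 + A) ^ n ≤ (1 + A) ^ (2 * n + 2) := pow_le_pow_right₀ h1A (by omega)
  have hn : 0 ≤ (n : ℝ) := by positivity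
  have hbn : 0 ≤ b₀ + (n : ℝ) * u := by positivity
  have hX0 : 0 ≤ 4 * A * (b₀ + (n : ℝ) * u) := by positivity
  have hstep1 : 4 * A * ((1 + A) ^ n * (b₀ + (n : ℝ) * u)) + w ≤
      (1 + A) ^ (2 * n + 2) * (4 * A * (b₀ + (n : ℝ) * u) + w) := by
    have h1 := mul_le_mul_of_nonneg_left hp3 hX0
    have h2 : w ≤ (1 + A) ^ (2 * n + 2) * w := le_mul_of_one_le_left hw hp2
    linarith
  have hstep2 : K₀ + (n : ℝ) * (4 * A * (b₀ + (n : ℝ) * u) + w) + (4 * A * (b₀ + (n : ℝ) * u) + w) ≤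
      K₀ + ((n : ℝ) + 1) * (4 * A * (b₀ + ((n : ℝ) + 1) * u) + w) := by
    have h1 : 4 * A * (b₀ + (n : ℝ) * u) + w ≤ 4 * A * (b₀ + ((n : ℝ) + 1) * u) + w := by nlinarith
    have h2 := mul_le_mul_of_nonneg_left h1 (by positivity : 0 ≤ (n : ℝ) + 1)
    linarith
  have hpow : (1 + A) ^ (2 * n) * (1 + A) ^ 2 = (1 + A) ^ (2 * n + 2) := by ring
  have hpow' : (1 + A) ^ (2 * (n + 1)) = (1 + A) ^ (2 * n + 2) := by ring_nf
  have hP0 : 0 ≤ (1 + A) ^ (2 * n + 2) := by positivity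
  rw [hpow']
  calc ((1 + A) ^ (2 * n) * (K₀ + (n : ℝ) * (4 * A * (b₀ + (n : ℝ) * u) + w)) * (1 + A) ^ 2 +
          4 * A * ((1 + A) ^ n * (b₀ + (n : ℝ) * u)) + w) * D
      = ((1 + A) ^ (2 * n + 2) * (K₀ + (n : ℝ) * (4 * A * (b₀ + (n : ℝ) * u) + w)) +
          (4 * A * ((1 + A) ^ n * (b₀ + (n : ℝ) * u)) + w)) * D := by rw [← hpow]; ring
    _ ≤ ((1 + A) ^ (2 * n + 2) * (K₀ + (n : ℝ) * (4 * A * (b₀ + (n : ℝ) * u) + w)) +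
          (1 + A) ^ (2 * n + 2) * (4 * A * (b₀ + (n : ℝ) * u) + w)) * D :=
        mul_le_mul_of_nonneg_right (add_le_add le_rfl hstep1) hD
    _ = (1 + A) ^ (2 * n + 2) *
          (K₀ + (n : ℝ) * (4 * A * (b₀ + (n : ℝ) * u) + w) + (4 * A * (b₀ + (n : ℝ) * u) + w)) * D := by ring
    _ ≤ (1 + A) ^ (2 * n + 2) * (K₀ + ((n : ℝ) + 1) * (4 * A * (b₀ + ((n : ℝ) + 1) * u) + w)) * D :=
        mul_le_mul_of_nonneg_right (mul_le_mul_of_nonneg_left hstep2 hP0) hD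
end Summit.Ventures.LatticeQCDFlow.Exactness
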